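import Summits.AtomisticToContinuum.Crystallization.Theorems.ChargedEnergyGapThawSplit
import HarnessLib

/-!
(SPLIT FOR THE 400-LINE CAP by the landing lane, hand-2 g41: this file = part 1 of 3; sequels `…ChargedEnergyGapDominoLedgerB`, `…ChargedEnergyGapDominoLedger` import it in a chain; same namespace, all FQNs unchanged.)
# ChargedEnergyGap · NODE 89 «DominoLedger» (lens-3 «one certified translation + split beneath», generation 88)

TARGET = the residual-deciding binder `hB1` (M¹) `BallMatchingSingleQ' cls₀ 80 20 130 106 (1/3600000000) (1/60000000) (1/2000000) (3/5) (1/3)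
3 (3/100) 160 80 (6/5) (3/2) (679/1000) (691/1000)` of the TREE cone `chargedEnergyGap_of_thawSplit_numerics` (`…Theorems.ChargedEnergyGapThawSplit`,
NODE 88; critic row 1558 (C) CLEARED + GO; margin of record `1.144` typed-faithful, binding family = the axis-aligned slab crease `L ≈ 118.1`,
comb phase `0`, cut `c = 80 + ρ + 0⁺`).

WHY THIS NODE.  Row 1558 (D) admitted the door [CHI-SPLIT] beneath (M¹) only if the χ-touching complement were FAT (`≥ 1.3`) under the
EDGE-ADVERSARY; FINDING «CHI-EDGE-88» (bus, desk `num/chiedge88.py`) priced it at `1.142` (cut sawtooth `c → (80 + ρ(1+|t|))⁻`), so by (D)(iv) the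
door is CLOSED and the generation is in [ALIGNED-EXTREMAL]: the statement that the aligned commensurate crease is the worst single-crossing
geometry.  The desk study of the true seven-point cost over cut geometries (`num/domino88.py` planar sheets, `num/dihedral88.py` dihedral creases,
point-cloud and mixed obstacles, `num/RESULTS-g88.md`) exhibits the mechanism in a typable form:
* per HOLE no law can hold (the half-phase slab marks BOTH parity classes at kink `J = 1` and true cost `≈ 0`; a per-hole charge double-counts and a
  per-line / per-column budget is false by `× 1.95`, NODES 82–85), but per PARITY DOMINO — two adjacent parallel lattice lines, whose holes have
  opposite phase — the marked true cost obeys a TWO-HOLE LAW: summed over the marked holes of one domino it is at most the cost of ONE crease hole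
  at the domino's SHEET DEPTH `d̃ = (pole depths mean) + ρ` (`= L` for every phase of a slab), maximised over everything else (phase, tilt, dihedral
  angle, partner); numerically (ADVERSARY of record: pattern search over ≤ 6-point obstacles + planes, `num/cap88.py adv|refine`) the maximiser
  for sheet depths `d̃ ≤ 120.5` is the TILTED TWO-FOOT obstacle (both feet `5.2°` off the axis towards one equatorial vertex), `1.025 ×` the aligned
  slab value `C₀(d̃)` at `d̃ = 118.1` (`1.014 ×` the untilted bipolar pair) — the SHAPE TAX every phase-free one-depth cap must pay — and every other
  sheet family is below: aligned slab `0.975`, dihedral creases `g = .97/.93/.88/.8/.7 ↦ .95/.86/.72/.53/.35`, planar tilts `2°/5°/12°/20° ↦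
  .92/.82/.58/.38`, crease-end / Y-junction partners `0`, oblate ring `.86`, random `k`-point obstacles `≤ .93` (of the two-foot value); beyond
  `d̃ ≈ 121` the JUNCTION holes of point-like obstacles (two kinked axes: four vertices at the pole depth) cost `≈ 39–41` and do not decay with the
  slab's cost (`36.9 (124)`, `16.9 (127)`, `0 (≥ 128.5)`) — they are codimension-two features (O(`R_N`) per ball), hence the PLATEAU letter;
* charging each domino ONCE, at its dominant marked hole, the cap `Ĉ(d̃) := c_T/10 + max (1.03·(tilted two-foot cost at d̃)) (45 c_T·𝟙[d̃ ≥ 120.5])`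
  turns the true ball moment into a PHASE-FREE, KINK-FREE, TABLE-FREE lattice count (`Ξ_D`), against which the slab pool still wins: est. margin
  `B(L)/Ĉ(L) = 1.081` at the binding `L ≈ 118.0–118.2` (`1.105 (117.19)`, `1.117 (119.19)`, `1.20 (116 | 120)`, `≥ 1.33 (L ≥ 121)`), uniformly in
  the comb phase (the phase structure that made every frozen table THIN at its row floors, ROWEDGE-87, is maximised out analytically instead of
  tabulated; the price is the shape tax `2.5 %` + the adversary slack `3 %`: `1.144 → 1.081`).

THE SPLIT (this file): (M¹) ⟸ (DL) ∧ (DT), glue PROVED, no table, no numeric side conditions beyond `0 < s`, `0 < ρlo` (`norm_num` at the designate).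
* (DL) `DominoLawQ'` — THE DOMINO LAW [LOCAL · TWO-HOLE · RESIDUAL (conjecture, desk evidence above; typed over GENUINE distance functions
  `latDepth C` of an invariant cut set, not over axiomatised depth tuples — Lipschitz + semiconcavity alone admit fake patterns up to `1.29 C₀`) ·
  UNDECIDED(test: seven-point LP ADVERSARY census of `domSum/Ĉ` over cut geometries; desk slack `3.1 %` on the bulk `d̃ ≤ 120.5` (adversary-converged
  two-foot optimum from every seed), `≥ 9 %` on the plateau, aligned slab `5.5 %`, every other family `≥ 8 %`) · ATTACKABLE-L ([ALIGNED-EXTREMAL] as a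
  finite-dimensional extremal problem: the seven depths of a hole depend on ≤ 7 feet of the cut set, so the law is a statement about ≤ 14-point
  configurations and the LP `roofVal T75`) · INSTRUMENTABLE · why it might fail: an invariant cut set realising inside a single-crossing ball, at the ≤ 2
  marked holes of one domino, six-depth patterns beating `1.03 ×` the tilted two-foot cost (bulk) or `45 c_T` (plateau) at the dominant sheet depth ·
  why strictly weaker than (M¹): no pool, no matching, no ball sum — a statement about ≤ 2 holes; it does not imply (M¹) (check `MustFail89.lean`)]
* (DT) `DominoMatchingQ'` — THE DOMINO MATCHING [RESIDUAL-DECIDING · = (M¹) VERBATIM with `ballMoment ↦ domMoment` (rest pairs at true cost + `Ĉ(d̃)`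
  once per domino with a marked hole near the site) · SUFFICIENT jointly with (DL) (the shape of NODE 81's (KC) ∧ (M_F), with the table replaced by a
  one-variable cap and the hole by the domino) · UNDECIDED(test: census of `Ξ_D/Π²` — slab ALL phases `L ∈ [116, 121]` under EDGE-ADVERSARY, half-phase
  slab, Voronoi vertex of a point lattice, tetrahedral apex, Y-junction crease end, bipolar disc; est. margin `1.081` binding = every phase of the
  aligned slab at `L ≈ 118.1` (`B(L)/Ĉ(L)` with the typed budget `B = P_atoms − ℓ_light` of true87: `44.2/46.3/48.4/51.7/54.8/59.5/65.3` at
  `L = 116/117.19/118.1/119.19/120/121/122`); the flat sheet is the extremal sheet family: single crossing bounds the dominoes by the `a`-line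
  pairs meeting the ball (maximal for a sheet `⊥ a`: tilted sheets `≈ 1.081/cos θ`) and `1`-Lipschitz depth makes the flat slab's surroundings the
  shallowest (smallest pool); bipolar disc `≈ 4`, junction lines fat by counting) · INSTRUMENTABLE (a lattice count: no phase, no kink, no table) ·
  ATTACKABLE-L (domino count × `Ĉ(L)` vs pool: both sides are functions of the cut geometry at scale `R_N`, the comb phase is gone) · why it might
  fail: a single-crossing geometry with MORE charged dominoes per pool than the slab (several marked families in one ball, each charged at full `Ĉ`) ·
  why strictly weaker than (M¹) in content: its moment is an explicit majorant count; it does not imply (M¹) without (DL) (check `MustFail89.lean`)]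
GLUE (PROVED): `ballMatchingSingleQ'_of_dominoLedger : 0 < s → 0 < ρlo → (DL) → (DT) → (M¹)` for ANY class and constants, through
`dl_ballLoad_eq_rest_add_line` (true load = rest + line part), `dl_ballLine_le_marked` (HOLE RE-INDEXING at true cost: the line part is at most the
thawed hole costs `holeCost` of the marked holes — (LS) + injectivity of the pole-pair map, NO table), `dl_marked_le_dominant` (DOMINO REGROUPING: a
finite marked set splits into domino classes, each with a unique rank-maximal = dominant hole; class sums bounded by the law) and
`dl_ballMoment_le_domMoment` (pools are non-negative).  DESIGNATE: `ballMatchingSingleQ'_designate_of_dominoLedger`; CONE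
`chargedEnergyGap_of_dominoLedger_numerics` = NODE 88's 32 binders VERBATIM with `hB1 ↦ hDL hDT` (33 binders; `hB2` is discharged by name as before:
`ballMatchingMultiQ'_designate_of_lineMulti hKC hMM`).

«Why novel»: the balancing unit of the crease ledger is identified as the PARITY DOMINO (the smallest lattice object whose two holes always carry
opposite comb phases), which lets the phase / kink variable be MAXIMISED OUT of the residual instead of tabulated: the residual functional becomes a
lattice count with a one-variable cap, and the extremality content ([ALIGNED-EXTREMAL]) is isolated as a two-hole local law over distance functions.
NODE 81 keyed a table per hole on (min-depth, max-kink); NODES 82–86 budgeted kinks per line; this node has no kink key at all.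

Imports ONLY the tree file `…ChargedEnergyGapThawSplit` (NODE 88) and `HarnessLib`; no options, no holes, no instance, no notation, no new tables;
five new rational constants (`1/10`, `103/100`, `45`, `241/2` inside `domCap`; the tilt `44/485 : 483/485` inside `tiltSext`); namespace
`…Theorems.ChargedEnergyGapChartDial`; new declaration names.
-/

noncomputable section

open scoped Classical
open Literature.MathematicalPhysics.StatisticalMechanics Literature.Geometry.DiscreteGeometry
open Summit.AtomisticToContinuum.Crystallization.Theses.PricedLinkCensus
open Summit.AtomisticToContinuum.Crystallization.Theorems.ChargedEnergyGapNegative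

namespace Summit.AtomisticToContinuum.Crystallization.Theorems.ChargedEnergyGapChartDial

/-! ## §89.1 The domino calculus: thawed hole cost, two-letter cap, sheet depth, domino key, dominant hole -/
section DominoCalculus

/-- ★ The **THAWED HOLE COST** of the lattice hole `w` of a cubic frame: one sixth of the true seven-point cost `frameVal (roofVal T75) τ W` (clipped
below at `0`) summed over the SIX ordered axis-antipodal pole pairs of the frame octahedron centred at `cubicPt c₀ f ρ w`.  No table. -/
def holeCost (τ : ℝ) (W : E3 → ℝ) (P : PeriodicConfiguration 3) (r₁ : ℝ) (c₀ : E3) (f : Fin 3 → E3) (ρ : ℝ) (w : Fin 3 → ℤ) : ℝ :=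
  ∑ u : Fin 3 × Bool, (1 / 6) * max 0 (frameVal (roofVal T75) τ W P r₁ (octVertex (cubicPt c₀ f ρ w) f ρ u.1 (!u.2))
    (octVertex (cubicPt c₀ f ρ w) f ρ u.1 u.2))

/-- `0 ≤ holeCost`. [formal bookkeeping] -/
theorem holeCost_nonneg (τ : ℝ) (W : E3 → ℝ) (P : PeriodicConfiguration 3) (r₁ : ℝ) (c₀ : E3) (f : Fin 3 → E3) (ρ : ℝ)
    (w : Fin 3 → ℤ) : 0 ≤ holeCost τ W P r₁ c₀ f ρ w :=
  Finset.sum_nonneg fun _ _ => mul_nonneg (by norm_num) (le_max_left _ _)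

/-- ★ The **TILTED TWO-FOOT SEXTUPLE** at sheet depth `d`: the six vertex weights of the crease hole whose obstacle is the two-point set
`{p± ± δ·u}` with `δ = d − ρ` the pole depth and BOTH feet tilted off the hole's axis by the fixed angle `η₀ = 5.205°`
(`(sin η₀, cos η₀) = (44/485, 483/485)`) towards the same equatorial vertex: poles at depth `δ`, equator at
`√(δ² + 2ρ² + 2δρ·k)` with `k = cos η₀ − sin η₀ | cos η₀ + sin η₀ | cos η₀ | cos η₀` (profile `depthProfile ϱ`).  Desk (g88 `cap88.py adv|refine`,
pattern search over ≤ 6-point obstacles + planes from 60 structured and random seeds): for every sheet depth `d ≤ 120.5` the supremum of the thawed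
hole cost over genuine distance functions is attained by this two-foot family (free tilt optimum `η* ∈ [5.2°, 5.6°]`, within `10⁻⁴` of the fixed-tilt
value; `1.025 ×` the aligned slab hole at `d = 118.1`, `1.014 ×` the untilted bipolar pair). -/
def tiltSext (ϱ ρ d : ℝ) : Fin 3 × Bool → ℝ :=
  sext (depthProfile ϱ (d - ρ)) (depthProfile ϱ (d - ρ))
    (depthProfile ϱ (Real.sqrt ((d - ρ) ^ 2 + 2 * ρ ^ 2 + 2 * (d - ρ) * ρ * (439 / 485))))
    (depthProfile ϱ (Real.sqrt ((d - ρ) ^ 2 + 2 * ρ ^ 2 + 2 * (d - ρ) * ρ * (527 / 485))))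
    (depthProfile ϱ (Real.sqrt ((d - ρ) ^ 2 + 2 * ρ ^ 2 + 2 * (d - ρ) * ρ * (483 / 485))))
    (depthProfile ϱ (Real.sqrt ((d - ρ) ^ 2 + 2 * ρ ^ 2 + 2 * (d - ρ) * ρ * (483 / 485))))

/-- ★★ The **DOMINO CAP** `Ĉ(d) := unit/10 + max (103/100 · (τ·2ρ)² · roofVal T75 (tilted two-foot sextuple at d)) (45·unit · 𝟙[241/2 ≤ d])`
— a function of ONE depth (no kink, no phase, no table).  In units of `c_T` (`ρ = .687`, `ϱ = 160`): the two-foot letter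
`1.03 × {0.17 (100), 2.83 (106), 10.44 (110), 26.2 (114), 35.7 (116), 43.4 (118.1), 44.8 (119.2, peak), 44.1 (120), 42.5 (120.5)}`; the
PLATEAU letter `45` from `d = 120.5` to the activity limit `d < 130.7` covers the junction (two-axis, "cross") holes of point-like obstacles, whose
cost `≈ 39–41` on `[120.5, 123]` does not decay with the slab's (`36.9 (124)`, `24.5 (126)`, `16.9 (127)`, `3.9 (128)`, `0 (≥ 128.5)`), and
under which the slab budget is fat (`B(L) ≥ 57`).  Adversary slack: `3.1 %` on the bulk, `≥ 9 %` on the plateau (RESULTS-g88 §E–§G). -/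
def domCap (unit ϱ τ ρ d : ℝ) : ℝ :=
  unit / 10 + max (103 / 100 * ((τ * (2 * ρ)) ^ 2 * roofVal T75 (tiltSext ϱ ρ d))) (if (241 / 2 : ℝ) ≤ d then 45 * unit else 0)

/-- ★ The **SHEET DEPTH** (charging depth) of the hole `w` for the depth field `d`: the mean depth of its two poles on the attributed axis
`hAxis ρ d w`, plus `ρ` — equal to the crease depth `L` for EVERY comb phase `|t| ≤ 1` of a slab. -/
def chargeDepth (ρ : ℝ) (d : (Fin 3 → ℤ) → ℝ) (w : Fin 3 → ℤ) : ℝ :=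
  (d (w + axisZ (hAxis ρ d w)) + d (w - axisZ (hAxis ρ d w))) / 2 + ρ

/-- ★ The **DOMINO KEY** of `w` for the axis `a`: forget the `a`-coordinate and round the `(a+1)`-coordinate down to even — two lattice points share
the key iff they lie on the same PARITY DOMINO (two adjacent `a`-parallel lattice lines `{(a+1)-coordinate ∈ {2k, 2k+1}}`, whose odd holes carry
opposite comb phases). -/
def domKey (a : Fin 3) (w : Fin 3 → ℤ) : Fin 3 → ℤ :=
  fun i => if i = a then 0 else if i = a + 1 then w i - w i % 2 else w i

/-- `w'` lies on the domino of `w`: same attributed axis and same domino key. -/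
def SameDomino (ρ : ℝ) (d : (Fin 3 → ℤ) → ℝ) (w w' : Fin 3 → ℤ) : Prop :=
  hAxis ρ d w' = hAxis ρ d w ∧ domKey (hAxis ρ d w) w' = domKey (hAxis ρ d w) w

/-- `sameDomino_refl` (docstring added by the landing lane; see the module docstring). [formal bookkeeping] -/
theorem sameDomino_refl (ρ : ℝ) (d : (Fin 3 → ℤ) → ℝ) (w : Fin 3 → ℤ) : SameDomino ρ d w w := ⟨rfl, rfl⟩

/-- `SameDomino.symm` (docstring added by the landing lane; see the module docstring). [formal bookkeeping] -/
theorem SameDomino.symm {ρ : ℝ} {d : (Fin 3 → ℤ) → ℝ} {w w' : Fin 3 → ℤ} (h : SameDomino ρ d w w') : SameDomino ρ d w' w := by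
  obtain ⟨ha, hk⟩ := h
  refine ⟨ha.symm, ?_⟩
  rw [ha]
  exact hk.symm

/-- `SameDomino.trans` (docstring added by the landing lane; see the module docstring). [formal bookkeeping] -/
theorem SameDomino.trans {ρ : ℝ} {d : (Fin 3 → ℤ) → ℝ} {w w' w'' : Fin 3 → ℤ} (h : SameDomino ρ d w w') (h' : SameDomino ρ d w' w'') :
    SameDomino ρ d w w'' := by
  obtain ⟨ha, hk⟩ := h
  obtain ⟨ha', hk'⟩ := h'
  refine ⟨ha'.trans ha, ?_⟩
  rw [ha] at hk'
  exact hk'.trans hk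

/-- The **DOMINO RANK** of a hole: (cap at its sheet depth, the hole) in the lexicographic order — the dominant hole of a domino is the rank-maximal
marked one (largest cap, ties broken by the lattice point). -/
def domRank (unit ϱ τ ρ : ℝ) (d : (Fin 3 → ℤ) → ℝ) (w : Fin 3 → ℤ) : Lex (ℝ × Lex (Fin 3 → ℤ)) :=
  toLex (domCap unit ϱ τ ρ (chargeDepth ρ d w), toLex w)

/-- `domRank_injective` (docstring added by the landing lane; see the module docstring). [formal bookkeeping] -/
theorem domRank_injective (unit ϱ τ ρ : ℝ) (d : (Fin 3 → ℤ) → ℝ) : Function.Injective (domRank unit ϱ τ ρ d) := by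
  intro w w' h
  unfold domRank at h
  exact toLex.injective (Prod.ext_iff.1 (toLex.injective h)).2

/-- ★ **DOMINANT HOLE** (for the marking predicate `mk` and the depth field `d`): marked, and rank-maximal among the marked holes of its domino.
Every domino with a marked hole has exactly one (`dl_marked_le_dominant`). -/
def IsDominant (unit ϱ τ ρ : ℝ) (d : (Fin 3 → ℤ) → ℝ) (mk : (Fin 3 → ℤ) → Prop) (w : Fin 3 → ℤ) : Prop :=
  mk w ∧ ∀ w', mk w' → SameDomino ρ d w w' → domRank unit ϱ τ ρ d w' ≤ domRank unit ϱ τ ρ d w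

end DominoCalculus

/-! ## §89.2 The domino ledger: rest load, line part, domino sum, domino load and moment -/
section DominoLoad

variable (ϱχ : ℝ) {m : ℕ} (D : Fin m → Set E3) (σ : Fin m → Bool)

/-- ★ The **THAWED REST LOAD** at `x`: true sixth-costs of the heavy active pairs near `x` that are NOT line pairs (`restLoad` of NODE 82 with
`frozenCost ↦ frameVal`). -/
def ballRest (R_N r_f dK dstar κ c_T cχ : ℝ) (P : PeriodicConfiguration 3) (C X : Set E3) (τ ϱ r₁ r₂ : ℝ) (x : E3) : ℝ :=
  ∑ᶠ p : E3 × E3,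
    if (HeavyActive ϱχ D σ r_f dK dstar κ c_T cχ P C X τ ϱ r₁ r₂ p.1 p.2 ∧ dist x p.1 ≤ R_N) ∧ ¬IsLinePair ϱχ D P C r₁ p.1 p.2 then
      (1 / 6) * frameVal (roofVal T75) τ (siteW ϱχ D σ X ϱ C) P r₁ p.1 p.2
    else 0

/-- ★ The **THAWED LINE PART** at `x`: true sixth-costs of the heavy active LINE pairs near `x` (`lineSum` of NODE 82 with `frozenCost ↦ frameVal`). -/
def ballLine (R_N r_f dK dstar κ c_T cχ : ℝ) (P : PeriodicConfiguration 3) (C X : Set E3) (τ ϱ r₁ r₂ : ℝ) (x : E3) : ℝ :=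
  ∑ᶠ p : E3 × E3,
    if (HeavyActive ϱχ D σ r_f dK dstar κ c_T cχ P C X τ ϱ r₁ r₂ p.1 p.2 ∧ dist x p.1 ≤ R_N) ∧ IsLinePair ϱχ D P C r₁ p.1 p.2 then
      (1 / 6) * frameVal (roofVal T75) τ (siteW ϱχ D σ X ϱ C) P r₁ p.1 p.2
    else 0

/-- ★ The **DOMINO SUM** at `x` of the hole `w` (cubic frame `(c₀, f, ρ)`): the thawed hole costs of the holes MARKED at `x` on the domino of `w`. -/
def domSum (R_N r_f dK dstar κ c_T cχ : ℝ) (P : PeriodicConfiguration 3) (C X : Set E3) (τ ϱ r₁ r₂ : ℝ) (c₀ : E3) (f : Fin 3 → E3) (ρ : ℝ)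
    (x : E3) (w : Fin 3 → ℤ) : ℝ :=
  ∑ᶠ w' : Fin 3 → ℤ,
    if IsMarked ϱχ D σ R_N r_f dK dstar κ c_T cχ P C X τ ϱ r₁ r₂ c₀ f ρ x w' ∧ SameDomino ρ (latDepth C c₀ f ρ) w w' then
      holeCost τ (siteW ϱχ D σ X ϱ C) P r₁ c₀ f ρ w'
    else 0

/-- ★★ The **DOMINO LOAD** at `x`: the thawed rest load plus `Ĉ(sheet depth)` ONCE per domino with a hole marked at `x` (at its dominant hole). -/
def domLoad (R_N unit r_f dK dstar κ c_T cχ : ℝ) (P : PeriodicConfiguration 3) (C X : Set E3) (τ ϱ r₁ r₂ : ℝ) (c₀ : E3) (f : Fin 3 → E3)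
    (ρ : ℝ) (x : E3) : ℝ :=
  ballRest ϱχ D σ R_N r_f dK dstar κ c_T cχ P C X τ ϱ r₁ r₂ x +
    ∑ᶠ w : Fin 3 → ℤ,
      if IsDominant unit ϱ τ ρ (latDepth C c₀ f ρ) (IsMarked ϱχ D σ R_N r_f dK dstar κ c_T cχ P C X τ ϱ r₁ r₂ c₀ f ρ x) w then
        domCap unit ϱ τ ρ (chargeDepth ρ (latDepth C c₀ f ρ) w)
      else 0

/-- ★★ The **DOMINO MOMENT** `Ξ_D(y) := Σ_x pool(x) · domLoad(x)` over the reference sites `x` with `dist x y ≤ R_N` — `ballMoment` of NODE 79/80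
with `ballLoad ↦ domLoad`: PHASE-FREE, KINK-FREE, TABLE-FREE. -/
def domMoment (R_N unit r_f dK dstar κ c_T cχ : ℝ) (P : PeriodicConfiguration 3) (C X : Set E3) (τ ϱ r₁ r₂ : ℝ) (c₀ : E3) (f : Fin 3 → E3)
    (ρ : ℝ) (y : E3) : ℝ :=
  ∑ᶠ x : E3,
    if x ∈ P.points ∧ dist x y ≤ R_N then
      pool ϱχ D σ r_f dK dstar κ c_T cχ P C X τ ϱ r₁ r₂ x * domLoad ϱχ D σ R_N unit r_f dK dstar κ c_T cχ P C X τ ϱ r₁ r₂ c₀ f ρ x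
    else 0

end DominoLoad

/-! ## §89.3 The pieces -/
section Pieces89

/-- ★★★ **(DL) THE DOMINO LAW** — for every reference of the class with a cubic frame `(c₀, f, ρ₀)`, every HEAVY ACTIVE CREASED ordered mid pair
`(y, z)` whose ball is SINGLE-CROSSING, every site `x` of the ball and every DOMINANT marked hole `w` at `x`: the thawed hole costs of the holes
marked at `x` on the domino of `w` sum to at most `Ĉ(sheet depth of w)`.
[LOCAL · TWO-HOLE (single crossing ⇒ ≤ 1 marked hole per line ⇒ ≤ 2 per domino) · RESIDUAL (conjecture; desk ADVERSARY (pattern search over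
≤ 6-point obstacles + planes): bulk supremum = tilted two-foot obstacle `0.969 Ĉ`, aligned slab `0.945`, dihedral creases `≤ .92`, tilted planes
`≤ .89`, crease-end / Y-junction partners `0`, oblate ring `.83`, random point clouds `≤ .89`; plateau: junction holes `≤ 0.91 Ĉ`) · UNDECIDED(test:
seven-point LP adversary census of `domSum/Ĉ`) · ATTACKABLE-L ([ALIGNED-EXTREMAL] as a two-hole extremal problem over ≤ 14 feet of the cut set) ·
INSTRUMENTABLE · why it might fail: a cut set realising at the ≤ 2 marked holes of one domino six-depth patterns beating `1.03 ×` the tilted two-foot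
cost (bulk) or `45 c_T` (plateau `d̃ ≥ 120.5`) · strictly weaker than (M¹) in content: no pool, no matching, ≤ 2 holes; does not imply (M¹)] -/
def DominoLawQ' (cls : Set E3 → Prop) (R_N r_f dK dstar κ c_T cχ unit : ℝ) (s lam ℓ τ ϱ ϱχ r₁ r₂ ρlo ρhi : ℝ) : Prop :=
  ∀ (P : PeriodicConfiguration 3) (C X : Set E3) (m : ℕ) (D : Fin m → Set E3) (σ : Fin m → Bool),
    IsSeparatedRef s P → IsLabelledRef lam ℓ P → cls P.points → IsForceFree P → IsSiteStressFree P →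
    IsInvariantSet P C → IsInvariantSet P X → (∀ i, IsInvariantSet P (D i)) → (∀ i, IsConvexPieces (2 * ϱχ) (D i)) →
    IsFramedOct P r₁ r₂ ρlo ρhi →
    ∀ (c₀ : E3) (f : Fin 3 → E3) (ρ₀ : ℝ), Orthonormal ℝ f → ρlo ≤ ρ₀ → ρ₀ ≤ ρhi → IsCubicFrameOf P r₁ r₂ c₀ f ρ₀ →
    ∀ y z : E3, HeavyActive ϱχ D σ r_f dK dstar κ c_T cχ P C X τ ϱ r₁ r₂ y z → ¬OctTame r_f C P r₁ y z →
      IsSingleCrossingBall ϱχ D σ R_N r_f dK dstar κ c_T cχ P C X τ ϱ r₁ r₂ c₀ f ρ₀ y →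
      ∀ x : E3, x ∈ P.points → dist x y ≤ R_N → ∀ w : Fin 3 → ℤ,
        IsDominant unit ϱ τ ρ₀ (latDepth C c₀ f ρ₀) (IsMarked ϱχ D σ R_N r_f dK dstar κ c_T cχ P C X τ ϱ r₁ r₂ c₀ f ρ₀ x) w →
        domSum ϱχ D σ R_N r_f dK dstar κ c_T cχ P C X τ ϱ r₁ r₂ c₀ f ρ₀ x w ≤ domCap unit ϱ τ ρ₀ (chargeDepth ρ₀ (latDepth C c₀ f ρ₀) w)

/-- ★★★ **(DT) THE DOMINO MATCHING** — (M¹) `BallMatchingSingleQ'` VERBATIM with the true ball moment replaced by the DOMINO MOMENT `domMoment`: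
for every reference of the class with a cubic frame and every heavy active creased ordered mid pair `(y, z)` whose ball is single-crossing,
`0 < Π(y)` and `Ξ_D(y) ≤ Π(y)²`.
[RESIDUAL-DECIDING · SUFFICIENT jointly with (DL) (glue `ballMatchingSingleQ'_of_dominoLedger`) · UNDECIDED(test: census of `Ξ_D/Π²`; est. margin
`1.081` = `B(L)/Ĉ(L)` at the binding slab `L ≈ 118.1`, UNIFORM in the comb phase; `≥ 1.10` off `L ∈ (117.2, 119.2)`; tilted sheets `≈ 1.081/cos θ`
(domino count ∝ cos θ, cap charged regardless of the true cost); bipolar discs and junction lines fat by counting) ·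
INSTRUMENTABLE (a lattice count with a one-variable cap) · ATTACKABLE-L · why it might fail: a single-crossing geometry with more charged dominoes per
unit pool than the slab (several marked families in one ball, each charged the full `Ĉ`) · strictly weaker than (M¹) in content: an explicit phase-free
majorant count; does not imply (M¹) without (DL)] -/
def DominoMatchingQ' (cls : Set E3 → Prop) (R_N r_f dK dstar κ c_T cχ unit : ℝ) (s lam ℓ τ ϱ ϱχ r₁ r₂ ρlo ρhi : ℝ) : Prop :=
  ∀ (P : PeriodicConfiguration 3) (C X : Set E3) (m : ℕ) (D : Fin m → Set E3) (σ : Fin m → Bool),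
    IsSeparatedRef s P → IsLabelledRef lam ℓ P → cls P.points → IsForceFree P → IsSiteStressFree P →
    IsInvariantSet P C → IsInvariantSet P X → (∀ i, IsInvariantSet P (D i)) → (∀ i, IsConvexPieces (2 * ϱχ) (D i)) →
    IsFramedOct P r₁ r₂ ρlo ρhi →
    ∀ (c₀ : E3) (f : Fin 3 → E3) (ρ₀ : ℝ), Orthonormal ℝ f → ρlo ≤ ρ₀ → ρ₀ ≤ ρhi → IsCubicFrameOf P r₁ r₂ c₀ f ρ₀ →
    ∀ y z : E3, HeavyActive ϱχ D σ r_f dK dstar κ c_T cχ P C X τ ϱ r₁ r₂ y z → ¬OctTame r_f C P r₁ y z →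
      IsSingleCrossingBall ϱχ D σ R_N r_f dK dstar κ c_T cχ P C X τ ϱ r₁ r₂ c₀ f ρ₀ y →
      0 < ballPool ϱχ D σ R_N r_f dK dstar κ c_T cχ P C X τ ϱ r₁ r₂ y ∧
        domMoment ϱχ D σ R_N unit r_f dK dstar κ c_T cχ P C X τ ϱ r₁ r₂ c₀ f ρ₀ y ≤
          ballPool ϱχ D σ R_N r_f dK dstar κ c_T cχ P C X τ ϱ r₁ r₂ y ^ 2

end Pieces89

end Summit.AtomisticToContinuum.Crystallization.Theorems.ChargedEnergyGapChartDial

end
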